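import Summits.Ventures.LatticeQCDFlow.Scoring.SU2CharacterRowIntegral
import Summits.Ventures.LatticeQCDFlow.Scoring.TorusRowDecomposition
import Summits.Ventures.LatticeQCDFlow.Scaling.PlaquetteIndependence2D
import HarnessLib

/-!
# SU(2) on the 2-torus: merging the plaquettes of a lattice STRIP into the character of its boundary holonomy, inside the full product Haar integral

HONEST FRAMING: exact (Metropolis-corrected) sampling algorithms for lattice gauge theory;
figures of merit are autocorrelation/cost numbers at stated couplings and volumes; no
continuum-physics claim.

Venture `LatticeQCDFlow` (cell pub-lqcd), sub-topic `Scoring`; FANOUT row 5 (`s0-sun-a`), GEN-11.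
NEW WORK of the cell (placement rule); the local tool behind the exact SU(2) torus WILSON LOOPS and
POLYAKOV-LOOP correlators (the lead's NOT-TYPED items 'larger Wilson loops / Polyakov correlators',
RT-30 (146)).  On theory-2's lattice `(ℤ/L)²` write `h(x) = V(x,0)`, `v(x) = V(x,1)` for the links of a
configuration `V : E → SU(2)`, `U_x = h(x)·v(x+e₀)·h(x+e₁)⁻¹·v(x)⁻¹` for the plaquette at `x`
(`plaquetteHolonomy_vec2`) and `χ_n = U_n(a₀)` for the characters.

* §1 — bookkeeping: sites `![x, y]`, residues of `0 < a < c ≤ L`, ordered link products under `update`;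
* **`integral_mul_prod_strip_su2Character`** — MERGING A ROW OF `R` PLAQUETTES INTO A STRIP
  (`1 ≤ R ≤ L`, corner `(i, j')`): for every continuous spectator `F : (E → SU(2)) → ℝ` that does not
  depend on the interior vertical links `v(i+a,j')`, `0 < a < R`, and every assignment `m`,
  `∫ F · ∏_{a<R} χ_{m(i+a,j')}(U_{(i+a,j')}) dHaar^{⊗E}
     = [∀ a<R, m(i+a,j') = m(i,j')] · ((m(i,j')+1)^{R−1})⁻¹ ·
       ∫ F · χ_{m(i,j')}([h(i,j')⋯h(i+R−1,j')]·v(i+R,j')·[h(i,j'+1)⋯h(i+R−1,j'+1)]⁻¹·v(i,j')⁻¹) dHaar^{⊗E}`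
  — `R − 1` face mergings, each integrating ONE interior link with
  `SU2CharacterRowIntegral.integral_pi_su2_merge` (the convolution identity
  `∫ χ_n(αgβ)χ_m(γg⁻¹) dg = [n=m]χ_n(αγβ)/(n+1)` on a slice of the product measure).  For `R = L` the
  word is `P_{j'}·v(i,j')·P_{j'+1}⁻¹·v(i,j')⁻¹`, the annulus of the row cut open along `v(i,j')`.

The rectangle version (stacking `T` strips) is the next file; run backwards against the typed
full-torus integral (`SU2TorusCharacterIntegral`) it evaluates every loop insertion without any
complement / gluing machinery.  Elementary; nothing is cited; no `def`.
-/

noncomputable section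

open Real MeasureTheory Set Function Finset Polynomial.Chebyshev
open Literature.MathematicalPhysics.QuantumFieldTheory Literature.MathematicalPhysics.QuantumLattice
open Summit.Ventures.LatticeQCDFlow.Exactness
open Summit.Ventures.LatticeQCDFlow.Theory2.Lattice

namespace Summit.Ventures.LatticeQCDFlow.Scoring

variable {L : ℕ}

/-! ## §1. Bookkeeping: sites `![x, y]`, residues of small naturals, links off a plaquette -/

/-- Two sites of `(ℤ/L)²` written as pairs agree iff their coordinates agree. -/
theorem vec2_eq_iff {x y x' y' : ZMod L} : (![x, y] : Site 2 L) = ![x', y'] ↔ x = x' ∧ y = y' := by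
  constructor
  · intro h
    exact ⟨by simpa using congrFun h 0, by simpa using congrFun h 1⟩
  · rintro ⟨rfl, rfl⟩
    rfl

/-- Naturals `0 < a < c ≤ L` have distinct residues mod `L` (also when `c = L`). -/
theorem natCast_zmod_ne_of_pos_lt_le {a c : ℕ} (h0 : 0 < a) (hac : a < c) (hcL : c ≤ L) :
    (a : ZMod L) ≠ (c : ZMod L) := by
  intro e
  rw [ZMod.natCast_eq_natCast_iff'] at e
  rcases Nat.lt_or_ge c L with hc | hc
  · rw [Nat.mod_eq_of_lt (by omega), Nat.mod_eq_of_lt hc] at e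
    omega
  · have hcL' : c = L := le_antisymm hcL hc
    rw [hcL', Nat.mod_self, Nat.mod_eq_of_lt (by omega)] at e
    omega

/-- The plaquette holonomy at `![x, y]` in terms of the four links:
`U_{(x,y)} = h(x,y) · v(x+1,y) · h(x,y+1)⁻¹ · v(x,y)⁻¹`. -/
theorem plaquetteHolonomy_vec2 {G : Type*} [Group G] (V : GaugeConfig 2 L G) (x y : ZMod L) :
    plaquetteHolonomy V ![x, y] 0 1 =
      V (![x, y], 0) * V (![x + 1, y], 1) * (V (![x, y + 1], 0))⁻¹ * (V (![x, y], 1))⁻¹ := by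
  simp only [plaquetteHolonomy, shift_vec2_zero, shift_vec2_one]

/-- An ordered product of links is unchanged by updating a link that is not among them. -/
theorem list_prod_map_update_of_ne {G : Type*} [Monoid G] (V : GaugeConfig 2 L G) (e : Edge 2 L) (g : G)
    (l : List ℕ) (f : ℕ → Edge 2 L) (hf : ∀ k ∈ l, f k ≠ e) :
    (l.map fun k => update V e g (f k)).prod = (l.map fun k => V (f k)).prod := by
  congr 1
  exact List.map_congr_left fun k hk => by rw [update_of_ne (hf k hk)]

/-- `range (n+1)` products peel off their LAST factor. -/
theorem list_prod_range_succ {G : Type*} [Monoid G] (f : ℕ → G) (n : ℕ) :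
    ((List.range (n + 1)).map f).prod = ((List.range n).map f).prod * f n := by
  rw [List.range_succ, List.map_append, List.prod_append, List.map_singleton, List.prod_singleton]

/-- `range (n+1)` products peel off their FIRST factor. -/
theorem list_prod_range_succ_eq_head_mul {G : Type*} [Monoid G] (f : ℕ → G) (n : ℕ) :
    ((List.range (n + 1)).map f).prod = f 0 * ((List.range n).map fun k => f (k + 1)).prod := by
  rw [List.range_succ_eq_map, List.map_cons, List.prod_cons, List.map_map]
  rfl

variable [NeZero L]

/-! ## §2. Merging the plaquettes of one row of the rectangle into a strip -/

/-- **Merging a row of `R` plaquettes into a strip** (`1 ≤ R ≤ L`).  For a continuous spectator `F`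
not depending on the interior vertical links `v(i+a,j')`, `0 < a < R`, of the strip
`[i, i+R) × {j'}`:
`∫ F · ∏_{a<R} χ_{m(i+a,j')}(U_{(i+a,j')}) dHaar^{⊗E}
   = [∀ a < R, m(i+a,j') = m(i,j')] · ((m(i,j')+1)^{R−1})⁻¹ ·
       ∫ F · χ_{m(i,j')}([h(i,j')⋯h(i+R−1,j')] · v(i+R,j') · [h(i,j'+1)⋯h(i+R−1,j'+1)]⁻¹ · v(i,j')⁻¹) dHaar^{⊗E}`
(`R − 1` face mergings along the row). -/
theorem integral_mul_prod_strip_su2Character (i j' : ZMod L) (m : Site 2 L → ℕ) :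
    ∀ (R : ℕ), 1 ≤ R → R ≤ L →
    ∀ (F : GaugeConfig 2 L (Matrix.specialUnitaryGroup (Fin 2) ℂ) → ℝ), Continuous F →
      (∀ a : ℕ, 0 < a → a < R → ∀ V g, F (update V (![i + a, j'], 1) g) = F V) →
      ∫ V, F V * ∏ a ∈ range R,
          (U ℝ (m ![i + a, j'])).eval (su2a0 (plaquetteHolonomy V ![i + a, j'] 0 1))
          ∂(Measure.pi fun _ : Edge 2 L => haarProbability (Matrix.specialUnitaryGroup (Fin 2) ℂ)) =
        if (∀ a < R, m ![i + a, j'] = m ![i, j']) then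
          ((((m ![i, j'] : ℝ) + 1) ^ (R - 1)))⁻¹ *
            ∫ V, F V * (U ℝ (m ![i, j'])).eval (su2a0
              (((List.range R).map fun a : ℕ => V (![i + a, j'], 0)).prod * V (![i + R, j'], 1) *
                (((List.range R).map fun a : ℕ => V (![i + a, j' + 1], 0)).prod)⁻¹ * (V (![i, j'], 1))⁻¹))
              ∂(Measure.pi fun _ : Edge 2 L => haarProbability (Matrix.specialUnitaryGroup (Fin 2) ℂ))
        else 0 := by
  intro R
  induction R with
  | zero => intro h; omega
  | succ R' ih =>
    intro _ hRL F hFc hF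
    rcases Nat.eq_zero_or_pos R' with rfl | hR'
    · -- one plaquette: nothing to merge
      have hcond : ∀ a : ℕ, a < 0 + 1 → m ![i + a, j'] = m ![i, j'] := by
        intro a ha
        obtain rfl : a = 0 := by omega
        rw [Nat.cast_zero, add_zero]
      rw [if_pos hcond]
      simp only [zero_add, Nat.sub_self, pow_zero, inv_one, one_mul, Finset.range_one,
        Finset.prod_singleton, List.range_one, List.map_singleton, List.prod_singleton, Nat.cast_zero,
        add_zero, Nat.cast_one, plaquetteHolonomy_vec2]
    · -- merge the plaquette `R'` into the strip of the first `R'` plaquettes along `v(i+R',j')`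
      haveI : Fact (1 < L) := ⟨by omega⟩
      have h10 : (1 : ZMod L) ≠ 0 := one_ne_zero
      have hR'L : R' < L := by omega
      have hR'0 : (R' : ZMod L) ≠ 0 := fun h =>
        absurd (Nat.le_of_dvd hR' ((ZMod.natCast_eq_zero_iff R' L).1 h)) (by omega)
      -- Step 1: split off the last plaquette and apply the induction hypothesis with it as spectator
      set f : GaugeConfig 2 L (Matrix.specialUnitaryGroup (Fin 2) ℂ) → ℝ := fun V =>
        (U ℝ (m ![i + R', j'])).eval (su2a0 (plaquetteHolonomy V ![i + R', j'] 0 1)) with hf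
      have hfc : Continuous f := by
        refine continuous_su2Character_comp _ ?_
        unfold plaquetteHolonomy
        fun_prop
      have hfupd : ∀ a : ℕ, 0 < a → a < R' → ∀ V g, f (update V (![i + a, j'], 1) g) = f V := by
        intro a ha0 haR V g
        simp only [hf]
        rw [TwoDim.plaquetteHolonomy_update_vert]
        · intro h
          rw [vec2_eq_iff] at h
          exact natCast_zmod_ne_of_lt (by omega) hR'L (by omega) (add_left_cancel h.1).symm
        · intro h
          rw [shift_vec2_zero, vec2_eq_iff, add_assoc, ← Nat.cast_succ] at h
          exact natCast_zmod_ne_of_pos_lt_le ha0 (by omega) hRL (add_left_cancel h.1).symm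
      have hsplit : ∀ V : GaugeConfig 2 L (Matrix.specialUnitaryGroup (Fin 2) ℂ),
          F V * ∏ a ∈ range (R' + 1),
            (U ℝ (m ![i + a, j'])).eval (su2a0 (plaquetteHolonomy V ![i + a, j'] 0 1)) =
          (F V * f V) * ∏ a ∈ range R',
            (U ℝ (m ![i + a, j'])).eval (su2a0 (plaquetteHolonomy V ![i + a, j'] 0 1)) := by
        intro V
        rw [Finset.prod_range_succ]
        ring
      simp_rw [hsplit]
      rw [ih hR' (by omega) (fun V => F V * f V) (hFc.mul hfc)
        (fun a ha0 haR V g => by rw [hF a ha0 (by omega), hfupd a ha0 haR])]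
      -- Step 2: the merge along `c = v(i+R', j')`
      by_cases hC : ∀ a < R', m ![i + a, j'] = m ![i, j']
      · rw [if_pos hC]
        set c : Edge 2 L := (![i + R', j'], 1) with hc
        -- the three link words: bottom path, (top path)⁻¹·v(i,j')⁻¹, and the open plaquette `R'`
        set α : GaugeConfig 2 L (Matrix.specialUnitaryGroup (Fin 2) ℂ) → Matrix.specialUnitaryGroup (Fin 2) ℂ :=
          fun V => ((List.range R').map fun a : ℕ => V (![i + a, j'], 0)).prod with hα
        set β : GaugeConfig 2 L (Matrix.specialUnitaryGroup (Fin 2) ℂ) → Matrix.specialUnitaryGroup (Fin 2) ℂ :=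
          fun V => (((List.range R').map fun a : ℕ => V (![i + a, j' + 1], 0)).prod)⁻¹ * (V (![i, j'], 1))⁻¹
          with hβ
        set γ : GaugeConfig 2 L (Matrix.specialUnitaryGroup (Fin 2) ℂ) → Matrix.specialUnitaryGroup (Fin 2) ℂ :=
          fun V => V (![i + R', j'], 0) * V (Site.shift (![i + R', j'] : Site 2 L) 0, 1) *
            (V (Site.shift (![i + R', j'] : Site 2 L) 1, 0))⁻¹ with hγ
        have hαu : ∀ V g, α (update V c g) = α V := fun V g =>
          list_prod_map_update_of_ne V c g _ _ fun k _ h => Fin.zero_ne_one (congrArg Prod.snd h)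
        have hβu : ∀ V g, β (update V c g) = β V := by
          intro V g
          simp only [hβ]
          rw [list_prod_map_update_of_ne V c g _ _ fun k _ h => Fin.zero_ne_one (congrArg Prod.snd h),
            update_of_ne]
          intro h
          rw [hc, Prod.mk.injEq, vec2_eq_iff] at h
          exact hR'0 (left_eq_add.mp h.1.1)
        have hγu : ∀ V g, γ (update V c g) = γ V := by
          intro V g
          simp only [hγ]
          rw [update_of_ne (fun h => Fin.zero_ne_one (congrArg Prod.snd h)), update_of_ne,
            update_of_ne (fun h => Fin.zero_ne_one (congrArg Prod.snd h))]
          intro h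
          rw [hc, Prod.mk.injEq, shift_vec2_zero, vec2_eq_iff] at h
          exact h10 (add_eq_left.mp h.1.1)
        have hαc : Continuous α := continuous_list_prod _ fun k _ => continuous_apply _
        have hβc : Continuous β := by
          refine Continuous.mul (Continuous.inv ?_) (continuous_apply _).inv
          exact continuous_list_prod _ fun k _ => continuous_apply _
        have hγc : Continuous γ := by simp only [hγ]; fun_prop
        have hmerge := integral_pi_su2_merge (ι := Edge 2 L) c α β γ F hαu hβu hγu
          (fun V g => hF R' hR' (by omega) V g) hαc hβc hγc hFc (m ![i, j']) (m ![i + R', j'])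
        -- bring the integrand to merge form
        have hpt : ∀ V : GaugeConfig 2 L (Matrix.specialUnitaryGroup (Fin 2) ℂ),
            F V * f V * (U ℝ (m ![i, j'])).eval (su2a0
              (((List.range R').map fun a : ℕ => V (![i + a, j'], 0)).prod * V c *
                (((List.range R').map fun a : ℕ => V (![i + a, j' + 1], 0)).prod)⁻¹ * (V (![i, j'], 1))⁻¹)) =
            (U ℝ (m ![i, j'])).eval (su2a0 (α V * V c * β V)) *
              (U ℝ (m ![i + R', j'])).eval (su2a0 (γ V * (V c)⁻¹)) * F V := by
          intro V
          have h1 : ((List.range R').map fun a : ℕ => V (![i + a, j'], 0)).prod * V c *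
              (((List.range R').map fun a : ℕ => V (![i + a, j' + 1], 0)).prod)⁻¹ * (V (![i, j'], 1))⁻¹ =
              α V * V c * β V := by
            simp only [hα, hβ, hc, mul_assoc]
          have h2 : f V = (U ℝ (m ![i + R', j'])).eval (su2a0 (γ V * (V c)⁻¹)) := by
            simp only [hf, hγ, hc, plaquetteHolonomy]
          rw [h1, h2]
          ring
        simp_rw [hpt]
        rw [hmerge]
        by_cases hmc : m ![i, j'] = m ![i + R', j']
        · have hC' : ∀ a < R' + 1, m ![i + a, j'] = m ![i, j'] := by
            intro a ha
            by_cases ha' : a < R'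
            · exact hC a ha'
            · obtain rfl : a = R' := by omega
              exact hmc.symm
          rw [if_pos hmc, if_pos hC', ← mul_assoc, ← mul_inv,
            show R' + 1 - 1 = (R' - 1) + 1 by omega, pow_succ]
          congr 1
          refine integral_congr_ae (Filter.Eventually.of_forall fun V => ?_)
          beta_reduce
          rw [mul_comm]
          congr 3
          -- the merged word is the strip of length `R' + 1`
          simp only [hα, hβ, hγ, list_prod_range_succ, shift_vec2_zero, shift_vec2_one, Nat.cast_succ,
            mul_inv_rev, ← add_assoc]
          group
        · have hC' : ¬ ∀ a < R' + 1, m ![i + a, j'] = m ![i, j'] := fun h =>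
            hmc (h R' (by omega)).symm
          rw [if_neg hmc, if_neg hC', mul_zero]
      · have hC' : ¬ ∀ a < R' + 1, m ![i + a, j'] = m ![i, j'] := fun h =>
          hC fun a ha => h a (by omega)
        rw [if_neg hC, if_neg hC']

end Summit.Ventures.LatticeQCDFlow.Scoring
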